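import Summits.HubbardSuperconductivity.HubbardLadder.NeelMarshallInfraredFloor
import Summits.HubbardSuperconductivity.HubbardLadder.NeelFoldedTables
import Summits.HubbardSuperconductivity.HubbardLadder.NeelRPCorrelationWindowTablesSix
import HarnessLib

/-!
# R2 device D20 — the fold-by-6 Marshall–infrared floor `m_s²(L) ≥ 2.8641/L²` for EVERY `L ∈ 6ℕ`

HONEST FRAMING: ladder R1–R4 with certified numbers; no claim on H/H₀. Cell pub-hubbard, seat r2
(gen 13). Each theorem is a statement about ONE finite matrix (the spin-½ Heisenberg antiferromagnet
`heisenbergTorus 2 L 1 J` on the `L×L` torus); none bears on H₀: the floor decays like `1/L²`.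

An ENERGY-FREE, SOLVER-FREE lower bound on the R2 observable `m_s²(L) = neelOrderParamSq L J =
3ĝ_Q/L²`, UNIFORM over the sides `L` divisible by `6`: **`m_s²(L) ≥ 2.8641/L²`**
(`neelOrderParamSq_ge_fold_six`), from `ĝ_Q ≥ 0.9547` (`heisStructureFactor_neel_ge_fold_six`; the
exact value of the folded programme is `0.954789800…`, i.e. `L² m_s² ≥ 2.8643694…`). Compare the
fold-by-2 closed form `1.8288/L²` (`NeelMarshallInfraredFloor`) and the Marshall floor `1.5/L²`
(D8).

METHOD (tables and dictionary: `NeelFoldedTables`). Sum the reduced two-point function `c(a,b)` over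
the `36` residue classes mod `6`, `F(ρ) = Σ_(a≡ρ₁, b≡ρ₂) c(a,b)`. The in-tree inputs — Marshall's
sign rule on the classes (M), `F(0,0) ≥ c(0,0) = ¼` (T), `F(ρ) ≤ c(0,±1), c(±1,0)` for the four
classes of the unit vectors, the singlet rule `Σ F = ĝ_0 = 0` and the Kennedy–Lieb–Shastry `T = 0`
infrared bound in tangent form at the momenta `(2π/6)(s₁,s₂)` with RATIONAL tangent points (I), the
bond correlation `ε` FREE — are the same finitely many linear inequalities in the `38` unknowns
`F(ρ), c(0,1), c(1,0)` for every such `L`, and ONE `linarith` certificate closes. Tangent points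
(momentum ↦ g₀): (0, 2) ↦ 23/137, (0, 3) ↦ 215/992, (1, 2) ↦ 215/992, (1, 3) ↦ 169/604, (1, 4) ↦
215/992, (2, 0) ↦ 23/137, (2, 1) ↦ 215/992, (2, 2) ↦ 119/317, (2, 3) ↦ 82/143, (2, 4) ↦ 119/317, (2,
5) ↦ 215/992, (3, 0) ↦ 215/992, (3, 1) ↦ 169/604, (3, 2) ↦ 82/143.

Rows (R2-TABLE §A8-M, column "fold-6 floor", hypothesis-free): `m_s²(18) ≥ 0.0088` (fold-2:
`0.0056`; Marshall D8: `0.0046`), `m_s²(24) ≥ 0.0049` (fold-4: `0.0045`), `m_s²(30) ≥ 0.0031`,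
`m_s²(36) ≥ 0.0022`; QMC comparators (never inputs) `≈ 0.12, 0.11, 0.11, 0.10` (Sandvik 1997).

References: T. Kennedy, E. H. Lieb, B. S. Shastry, J. Stat. Phys. 53 (1988) 1019, eqs. (12)–(19), p.
1021; E. Lieb, D. Mattis, J. Math. Phys. 3 (1962) 749, Thm 2; W. Marshall, Proc. Roy. Soc. A 232
(1955) 48; A. W. Sandvik, Phys. Rev. B 56 (1997) 11678 (comparators only).
-/

noncomputable section

open Finset Literature.MathematicalPhysics.QuantumLattice Literature.Probability.LatticeModels

namespace Summit.HubbardSuperconductivity.HubbardLadder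

set_option maxHeartbeats 4000000 in
/-- **The structure factor at `Q` is at least `0.9547` on every `2n × 2n` torus with `6 ∣ 2n`, `n ≥ 2`**
(spin ½; the fold-by-6 energy-free KLS programme with Marshall signs; exact value `0.954789800…`).
HONEST FRAMING: ladder R1–R4 with certified numbers; no claim on H/H₀.
[cite: KLS1988JSP, eqs. (12)–(19)] [cite: LiebMattis1962, Theorem 2] -/
theorem heisStructureFactor_neel_ge_fold_six (n m : ℕ) (hn : 2 ≤ n) (hL : 2 * n = m * 6) :
    (0.9547 : ℝ) ≤ heisStructureFactor 0 (2 * n) 1 (neelIndex (2 * n) : TorusSite 2 (2 * n)) := by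
  haveI : NeZero (2 * n) := ⟨by omega⟩
  have hm : m ≠ 0 := by omega
  obtain ⟨F, hF⟩ : ∃ F : ℕ → ℕ → ℝ, ∀ ρ₁ ρ₂, F ρ₁ ρ₂ =
      ∑ a ∈ (range (2 * n)).filter (fun a => a % 6 = ρ₁),
        ∑ b ∈ (range (2 * n)).filter (fun b => b % 6 = ρ₂), heisRedCorr2 (2 * n) 1 a b :=
    ⟨_, fun _ _ => rfl⟩
  obtain ⟨cw0, cw1, cw2, cw3, cw4, cw5⟩ := cosW_6
  have k2 : (2 : ℕ) ∣ 6 := by norm_num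
  -- (Z) singlet rule and (T) the class of the origin
  have hZ := fold_singlet n m 6 hn hL (by norm_num) F hF
  have hT := foldClass_zero_zero_ge n 6 F hF k2
  -- (M) Marshall signs of the classes
  have hM_0_1 := foldClass_nonpos n 6 F hF k2 0 1 (by norm_num)
  have hM_0_2 := foldClass_nonneg n 6 F hF k2 0 2 (by norm_num)
  have hM_0_3 := foldClass_nonpos n 6 F hF k2 0 3 (by norm_num)
  have hM_0_4 := foldClass_nonneg n 6 F hF k2 0 4 (by norm_num)
  have hM_0_5 := foldClass_nonpos n 6 F hF k2 0 5 (by norm_num)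
  have hM_1_0 := foldClass_nonpos n 6 F hF k2 1 0 (by norm_num)
  have hM_1_1 := foldClass_nonneg n 6 F hF k2 1 1 (by norm_num)
  have hM_1_2 := foldClass_nonpos n 6 F hF k2 1 2 (by norm_num)
  have hM_1_3 := foldClass_nonneg n 6 F hF k2 1 3 (by norm_num)
  have hM_1_4 := foldClass_nonpos n 6 F hF k2 1 4 (by norm_num)
  have hM_1_5 := foldClass_nonneg n 6 F hF k2 1 5 (by norm_num)
  have hM_2_0 := foldClass_nonneg n 6 F hF k2 2 0 (by norm_num)
  have hM_2_1 := foldClass_nonpos n 6 F hF k2 2 1 (by norm_num)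
  have hM_2_2 := foldClass_nonneg n 6 F hF k2 2 2 (by norm_num)
  have hM_2_3 := foldClass_nonpos n 6 F hF k2 2 3 (by norm_num)
  have hM_2_4 := foldClass_nonneg n 6 F hF k2 2 4 (by norm_num)
  have hM_2_5 := foldClass_nonpos n 6 F hF k2 2 5 (by norm_num)
  have hM_3_0 := foldClass_nonpos n 6 F hF k2 3 0 (by norm_num)
  have hM_3_1 := foldClass_nonneg n 6 F hF k2 3 1 (by norm_num)
  have hM_3_2 := foldClass_nonpos n 6 F hF k2 3 2 (by norm_num)
  have hM_3_3 := foldClass_nonneg n 6 F hF k2 3 3 (by norm_num)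
  have hM_3_4 := foldClass_nonpos n 6 F hF k2 3 4 (by norm_num)
  have hM_3_5 := foldClass_nonneg n 6 F hF k2 3 5 (by norm_num)
  have hM_4_0 := foldClass_nonneg n 6 F hF k2 4 0 (by norm_num)
  have hM_4_1 := foldClass_nonpos n 6 F hF k2 4 1 (by norm_num)
  have hM_4_2 := foldClass_nonneg n 6 F hF k2 4 2 (by norm_num)
  have hM_4_3 := foldClass_nonpos n 6 F hF k2 4 3 (by norm_num)
  have hM_4_4 := foldClass_nonneg n 6 F hF k2 4 4 (by norm_num)
  have hM_4_5 := foldClass_nonpos n 6 F hF k2 4 5 (by norm_num)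
  have hM_5_0 := foldClass_nonpos n 6 F hF k2 5 0 (by norm_num)
  have hM_5_1 := foldClass_nonneg n 6 F hF k2 5 1 (by norm_num)
  have hM_5_2 := foldClass_nonpos n 6 F hF k2 5 2 (by norm_num)
  have hM_5_3 := foldClass_nonneg n 6 F hF k2 5 3 (by norm_num)
  have hM_5_4 := foldClass_nonpos n 6 F hF k2 5 4 (by norm_num)
  have hM_5_5 := foldClass_nonneg n 6 F hF k2 5 5 (by norm_num)
  -- (M') the four classes of the unit vectors are bounded by single correlations
  have hS01 := foldClass_le_single n 6 F hF k2 0 1 0 1 (by norm_num) (by omega) (by norm_num)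
    (by omega) (by norm_num)
  have hS0p := foldClass_le_single n 6 F hF k2 0 5 0 (2 * n - 1) (by norm_num) (by omega)
    (by norm_num) (by omega) (by omega)
  rw [heisRedCorr2_zero_pred n (by omega)] at hS0p
  have hS10 := foldClass_le_single n 6 F hF k2 1 0 1 0 (by norm_num) (by omega) (by norm_num)
    (by omega) (by norm_num)
  have hSp0 := foldClass_le_single n 6 F hF k2 5 0 (2 * n - 1) 0 (by norm_num) (by omega)
    (by omega) (by omega) (by norm_num)
  rw [heisRedCorr2_pred_zero n (by omega)] at hSp0
  obtain ⟨hN01, hN10⟩ := heisRedCorr2_unit_nonpos n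
  -- (I) the infrared bound in tangent form at rational tangent points; `ε = (c(1,0)+c(0,1))/2` is free
  have hε := heisBondCorr_two_eq (2 * n) 1
  have hI_0_2 := ir_fold_tangent n m 6 0 2 hn hL (by norm_num) (by norm_num) (by omega)
    (by norm_num [cw0, cw1, cw2, cw3, cw4, cw5]) F hF (23/137)
  have hI_0_3 := ir_fold_tangent n m 6 0 3 hn hL (by norm_num) (by norm_num) (by omega)
    (by norm_num [cw0, cw1, cw2, cw3, cw4, cw5]) F hF (215/992)
  have hI_1_2 := ir_fold_tangent n m 6 1 2 hn hL (by norm_num) (by norm_num) (by omega)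
    (by norm_num [cw0, cw1, cw2, cw3, cw4, cw5]) F hF (215/992)
  have hI_1_3 := ir_fold_tangent n m 6 1 3 hn hL (by norm_num) (by norm_num) (by omega)
    (by norm_num [cw0, cw1, cw2, cw3, cw4, cw5]) F hF (169/604)
  have hI_1_4 := ir_fold_tangent n m 6 1 4 hn hL (by norm_num) (by norm_num) (by omega)
    (by norm_num [cw0, cw1, cw2, cw3, cw4, cw5]) F hF (215/992)
  have hI_2_0 := ir_fold_tangent n m 6 2 0 hn hL (by norm_num) (by norm_num) (by omega)
    (by norm_num [cw0, cw1, cw2, cw3, cw4, cw5]) F hF (23/137)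
  have hI_2_1 := ir_fold_tangent n m 6 2 1 hn hL (by norm_num) (by norm_num) (by omega)
    (by norm_num [cw0, cw1, cw2, cw3, cw4, cw5]) F hF (215/992)
  have hI_2_2 := ir_fold_tangent n m 6 2 2 hn hL (by norm_num) (by norm_num) (by omega)
    (by norm_num [cw0, cw1, cw2, cw3, cw4, cw5]) F hF (119/317)
  have hI_2_3 := ir_fold_tangent n m 6 2 3 hn hL (by norm_num) (by norm_num) (by omega)
    (by norm_num [cw0, cw1, cw2, cw3, cw4, cw5]) F hF (82/143)
  have hI_2_4 := ir_fold_tangent n m 6 2 4 hn hL (by norm_num) (by norm_num) (by omega)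
    (by norm_num [cw0, cw1, cw2, cw3, cw4, cw5]) F hF (119/317)
  have hI_2_5 := ir_fold_tangent n m 6 2 5 hn hL (by norm_num) (by norm_num) (by omega)
    (by norm_num [cw0, cw1, cw2, cw3, cw4, cw5]) F hF (215/992)
  have hI_3_0 := ir_fold_tangent n m 6 3 0 hn hL (by norm_num) (by norm_num) (by omega)
    (by norm_num [cw0, cw1, cw2, cw3, cw4, cw5]) F hF (215/992)
  have hI_3_1 := ir_fold_tangent n m 6 3 1 hn hL (by norm_num) (by norm_num) (by omega)
    (by norm_num [cw0, cw1, cw2, cw3, cw4, cw5]) F hF (169/604)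
  have hI_3_2 := ir_fold_tangent n m 6 3 2 hn hL (by norm_num) (by norm_num) (by omega)
    (by norm_num [cw0, cw1, cw2, cw3, cw4, cw5]) F hF (82/143)
  rw [hε] at hI_0_2 hI_0_3 hI_1_2 hI_1_3 hI_1_4 hI_2_0 hI_2_1
  rw [hε] at hI_2_2 hI_2_3 hI_2_4 hI_2_5 hI_3_0 hI_3_1 hI_3_2
  -- the objective `ĝ_Q` as a signed class sum, then one linear certificate
  rw [heisStructureFactor_neel_fold n m 6 3 hL (by omega) hm (by norm_num) F hF]
  simp only [sum_range_succ, sum_range_zero, zero_add] at hZ hI_0_2 hI_0_3 hI_1_2 hI_1_3 hI_1_4 hI_2_0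
  simp only [sum_range_succ, sum_range_zero, zero_add] at hI_2_1 hI_2_2 hI_2_3 hI_2_4 hI_2_5 hI_3_0 hI_3_1
  simp only [sum_range_succ, sum_range_zero, zero_add] at hI_3_2 ⊢
  norm_num [cw0, cw1, cw2, cw3, cw4, cw5] at hZ hI_0_2 hI_0_3 hI_1_2 hI_1_3 hI_1_4 hI_2_0
  norm_num [cw0, cw1, cw2, cw3, cw4, cw5] at hI_2_1 hI_2_2 hI_2_3 hI_2_4 hI_2_5 hI_3_0 hI_3_1
  norm_num [cw0, cw1, cw2, cw3, cw4, cw5] at hI_3_2 ⊢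
  linarith

/-- **R2 device D20, uniform row: `m_s²(L) ≥ 2.8641/L²`** for every `L` divisible by `6` and every
`J > 0` (energy-free, solver-free; fold-by-6 Marshall-augmented KLS programme). A statement about each
finite torus; decays like `1/L²`; no bearing on H₀.
HONEST FRAMING: ladder R1–R4 with certified numbers; no claim on H/H₀.
[cite: KLS1988JSP, eqs. (12)–(19)] [cite: LiebMattis1962, Theorem 2] -/
theorem neelOrderParamSq_ge_fold_six (L : ℕ) [NeZero L] (hL : 6 ∣ L) {J : ℝ} (hJ : 0 < J) :
    (2.8641 : ℝ) / (L : ℝ) ^ 2 ≤ neelOrderParamSq L J := by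
  obtain ⟨m, hm⟩ := hL
  have hL0 := NeZero.ne L
  obtain ⟨n, rfl⟩ : ∃ n, L = 2 * n := ⟨L / 2, by omega⟩
  have hG := heisStructureFactor_neel_ge_fold_six n m (by omega) (by omega)
  rw [neelOrderParamSq_two_mul_eq n hJ]
  have hpos : (0 : ℝ) < ((2 * n : ℕ) : ℝ) := by positivity
  rw [show (2.8641 : ℝ) / ((2 * n : ℕ) : ℝ) ^ 2 = 3 * ((2.8641 / 3) / ((2 * n : ℕ) : ℝ) ^ 2) by ring]
  gcongr
  linarith

/-! ### Rows (R2-TABLE §A8-M, column "fold-6 floor"; hypothesis-free) -/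

/-- From the uniform floor: `c · L² ≤ 2.8641` gives `c ≤ m_s²(L)`. [folklore] -/
private theorem row_of_fold_six {L : ℕ} [NeZero L] (hL : 6 ∣ L) {J : ℝ} (hJ : 0 < J) {c : ℝ}
    (hc : c * (L : ℝ) ^ 2 ≤ 2.8641) : c ≤ neelOrderParamSq L J := by
  have h := neelOrderParamSq_ge_fold_six L hL hJ
  have hL0 : (0 : ℝ) < (L : ℝ) := by exact_mod_cast Nat.pos_of_ne_zero (NeZero.ne L)
  exact le_trans (by rw [le_div_iff₀ (by positivity)]; exact hc) h

/-- Row A8.18 (fold-6 column): `0.0088 ≤ m_s²(18)` for every `J > 0` (`2.8641/324`); energy-free;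
no claim on H/H₀. [cite: KLS1988JSP, eqs. (12)–(19)] [cite: LiebMattis1962, Theorem 2] -/
theorem neelOrderParamSq_eighteen_ge_fold_six (J : ℝ) (hJ : 0 < J) :
    (0.0088 : ℝ) ≤ neelOrderParamSq 18 J :=
  row_of_fold_six (by norm_num) hJ (by norm_num)

/-- Row A8.24 (fold-6 column): `0.0049 ≤ m_s²(24)` for every `J > 0` (`2.8641/576`); energy-free;
no claim on H/H₀. [cite: KLS1988JSP, eqs. (12)–(19)] [cite: LiebMattis1962, Theorem 2] -/
theorem neelOrderParamSq_twentyFour_ge_fold_six (J : ℝ) (hJ : 0 < J) :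
    (0.0049 : ℝ) ≤ neelOrderParamSq 24 J :=
  row_of_fold_six (by norm_num) hJ (by norm_num)

/-- Row A8.30 (fold-6 column): `0.0031 ≤ m_s²(30)` for every `J > 0` (`2.8641/900`); energy-free;
no claim on H/H₀. [cite: KLS1988JSP, eqs. (12)–(19)] [cite: LiebMattis1962, Theorem 2] -/
theorem neelOrderParamSq_thirty_ge_fold_six (J : ℝ) (hJ : 0 < J) :
    (0.0031 : ℝ) ≤ neelOrderParamSq 30 J :=
  row_of_fold_six (by norm_num) hJ (by norm_num)

/-- Row A8.36 (fold-6 column): `0.0022 ≤ m_s²(36)` for every `J > 0` (`2.8641/1296`); energy-free;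
no claim on H/H₀. [cite: KLS1988JSP, eqs. (12)–(19)] [cite: LiebMattis1962, Theorem 2] -/
theorem neelOrderParamSq_thirtySix_ge_fold_six (J : ℝ) (hJ : 0 < J) :
    (0.0022 : ℝ) ≤ neelOrderParamSq 36 J :=
  row_of_fold_six (by norm_num) hJ (by norm_num)

/-- Row A8.18 upper: `m_s²(18) ≤ 0.2531` (`¼ + 1/324 = 0.25308…`, operator ceiling).
[cite: Tasaki2020, §2.2, App. A.3] -/
theorem neelOrderParamSq_eighteen_le (J : ℝ) : neelOrderParamSq 18 J ≤ 0.2531 := by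
  have h := neelOrderParamSq_le 17 (by norm_num) J
  norm_num at h ⊢
  linarith

/-- Two-sided kernel bracket at `L = 18`: `m_s²(18) ∈ [0.0088, 0.2531]` for every `J > 0` (no
hypothesis; QMC comparator `≈ 0.12`). [cite: KLS1988JSP, eqs. (12)–(19)] [cite: Tasaki2020, §2.2] -/
theorem neelOrderParamSq_eighteen_mem_Icc_fold (J : ℝ) (hJ : 0 < J) :
    neelOrderParamSq 18 J ∈ Set.Icc (0.0088 : ℝ) 0.2531 :=
  ⟨neelOrderParamSq_eighteen_ge_fold_six J hJ, neelOrderParamSq_eighteen_le J⟩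

end Summit.HubbardSuperconductivity.HubbardLadder
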